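import Summits.AtomisticToContinuum.Crystallization.Theorems.FreeSplittingCertificatesStrictSplittingRuleLineTrussMajorantSum

/-!
# `StrictSplittingRule` (stmt-AtomisticToContinuum-12560): the true-β inflation bound — tension of the landed design, both orientations

Route `FreeSplittingCertificates`, crux r3 `StrictSplittingRule`, line `registered` (unit b2b-freesplit-B, gen 14); sequel of
`…LineTrussMajorantSum.lean` in the hypothesis style of `…CoreFirstOrderDesignTruss.lean` / `…LineTrussAsymptoticsTau.lean`
(`hV`, `hF`, `hτ`).  For a stencil direction `s ∈ Y₁` and `d ≠ 0`, `r = ‖V c d‖`, `C = 14 + 56r⁻⁶`: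

* `h1_tau_asymp2` — `|τ c s d + ½V_LJ(r) + ½W′(r²)⟪V c d, y_s⟫| ≤ (C/32)‖y_s‖²r⁻⁸` for BOTH orientations (the first-order
  anisotropy `−½W′(r²)⟪V c d, y_s⟫` is orientation-independent: incoming = outgoing on `−y_s` plus the node's own load);
* `h1_tau_asymp_sharp` — `|τ c s d + ½V_LJ(r)| ≤ ¼(1+r⁻⁶)‖y_s‖r⁻⁷ + (C/32)‖y_s‖²r⁻⁸`: the statement of the tree's `h1_tau_asymp`
  with constants of order one (its constant is `≈ 3.9·10³` at the hcp minimiser, usable only beyond `≈ 10⁴` spacings);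
* `h1_tau_inflation_le` — `12r⁶τ ≤ 1 + 3(1+r⁻⁶)(‖y_s‖/r) + (21/4 + 21r⁻⁶)(‖y_s‖/r)²`;
* `h1_tau_inflation_num` — with `‖y_s‖ ≤ 8/5` (`‖y_s‖ ∈ {a, 2h}`, `2h < 1.587` on the certified box): `12r⁶τ ≤ 16/5` for `r ≥ 39/10`,
  `≤ 19/10` for `r ≥ 77/10`, `≤ 13/10` for `r ≥ 19`; `h1_tau_inflation_box` — the same from `0 < a ≤ 8/5`, `0 < h ≤ 4/5` alone
  (`h1_stencil_norm_le_box`), i.e. on the whole certified enclosure of the minimiser with no side condition.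

USE (HOME CERT.md §21, FAR-LEMMA-SPEC §12): the readout coefficient of the design is `β(b,d,s) = λ_s·τ`; the far pencil models it by
the isotropic `λ_s r⁻⁶/12`; the inflation `f = 12r⁶τ` the far budget must absorb is hereby certified IN THE KERNEL as `≤ 16/5` for
every far bond (`r ≥ 4.05a > 39/10`; true sup `2.64` by the interval table of CERT §20 (2d)), `≤ 19/10` from `8a` and `≤ 13/10` from
`20a` on — the python-exact table tier of FAR-LEMMA-SPEC §11 (d)(1) is no longer needed: budget `0.146·3.2·1.375 + 0.056 = 0.70 < 1`.
Structural bookkeeping ([folklore]); VALUE = a kernel-checked brick of the far lemma — NOT a proof of H12⋆, NOT summit progress.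
-/

noncomputable section

namespace Summit.AtomisticToContinuum.Crystallization.Theorems.StrictSplittingRuleBirth

open scoped BigOperators Topology
open Filter Set
open Literature.MathematicalPhysics.StatisticalMechanics
open Summit.AtomisticToContinuum.Crystallization.Theorems.PalmUnimodularRigidity.LayeredLawsSelectHcp

/-! ## §7 The tension of the landed design: sharp second-order form, both orientations, inflation factors from the interface on -/

section Tau3

variable {a h : ℝ} {V : Bool → ℤ × ℤ × ℤ → EuclideanSpace ℝ (Fin 3)} {F : Bool → (ℤ × ℤ × ℤ) → (ℤ × ℤ × ℤ) → ℤ → ℝ}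
  {τ : Bool → (ℤ × ℤ × ℤ) → (ℤ × ℤ × ℤ) → ℝ}

/-- **Sharp second-order asymptotics of the line-truss tension, both orientations.**  For `s ∈ Y₁`, `d ≠ 0`, `r = ‖V c d‖`:
`|τ c s d + ½V_LJ(r) + ½W′(r²)⟪V c d, y_s⟫| ≤ ((14 + 56r⁻⁶)/32)·‖y_s‖²·r⁻⁸` (outgoing: `h1_tail_asymp_sharp`; incoming: the same on
`−y_s` plus the node's own load). [folklore] -/
theorem h1_tau_asymp2 (ha : 0 < a) (hh : 0 < h)
    (hV : ∀ c d, V c d = if c = true then hcpSite a h d else -hcpSite a h (-d))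
    (hF : ∀ c s d n, F c s d n =
      ljSqDeriv (‖V c (d + n • s)‖ ^ 2) * inner ℝ (V c (d + n • s)) (hcpSite a h s))
    (hτ : ∀ c s d, τ c s d = if 0 ≤ inner ℝ (V c d) (hcpSite a h s) then ∑' m : ℕ, F c s d ((m : ℤ) + 1)
      else -(F c s d 0 + ∑' m : ℕ, F c s d (-((m : ℤ) + 1))))
    (c : Bool) {s : ℤ × ℤ × ℤ} (hs : s ∈ ({(0, 1, 0), (0, 0, 1), (0, -1, 1), (2, 0, 0)} : Finset (ℤ × ℤ × ℤ)))
    {d : ℤ × ℤ × ℤ} (hd : d ≠ 0) :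
    |τ c s d + 1 / 2 * lennardJones ‖V c d‖ +
        1 / 2 * (ljSqDeriv (‖V c d‖ ^ 2) * inner ℝ (V c d) (hcpSite a h s))| ≤
      (14 + 56 * (‖V c d‖⁻¹) ^ 6) / 32 * (‖hcpSite a h s‖ ^ 2 * (‖V c d‖⁻¹) ^ 8) := by
  set ρ₀ := min a h with hρ₀
  set e := hcpSite a h s with he_def
  set v := V c d with hv_def
  have hρ : 0 < ρ₀ := lt_min ha hh
  have hs0 : s ≠ 0 := by rintro rfl; exact absurd hs (by decide)
  have he : ρ₀ ≤ ‖e‖ := h1_norm_ge ha hh hs0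
  have hepos : 0 < ‖e‖ := hρ.trans_le he
  have hv : ρ₀ ≤ ‖v‖ := h1_V_norm_ge ha hh hV c hd
  have hvpos : 0 < ‖v‖ := hρ.trans_le hv
  have hline : ∀ n : ℤ, V c (d + n • s) = v + (n : ℝ) • e := h1_V_line hV c (h1_stencil_even hs) d
  have hFn : ∀ n : ℤ, F c s d n = ljSqDeriv (‖v + (n : ℝ) • e‖ ^ 2) * inner ℝ (v + (n : ℝ) • e) e := fun n => by
    rw [hF, hline]
  rw [hτ]
  split_ifs with hsg
  · -- outgoing
    have hcongr : ∑' m : ℕ, F c s d ((m : ℤ) + 1) =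
        ∑' m : ℕ, ljSqDeriv (‖v + ((m : ℝ) + 1) • e‖ ^ 2) * inner ℝ (v + ((m : ℝ) + 1) • e) e :=
      tsum_congr fun m => by rw [hFn]; push_cast; rfl
    rw [hcongr]
    exact h1_tail_asymp_sharp hvpos hepos hsg
  · -- incoming: reverse the direction and add the node's own load
    have hsg' : inner ℝ v e < 0 := not_le.mp hsg
    have hve' : 0 ≤ inner ℝ v (-e) := by rw [inner_neg_right]; linarith
    have hepos' : 0 < ‖-e‖ := by rwa [norm_neg]
    have hG : ∀ m : ℕ, F c s d (-((m : ℤ) + 1)) =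
        -(ljSqDeriv (‖v + ((m : ℝ) + 1) • (-e)‖ ^ 2) * inner ℝ (v + ((m : ℝ) + 1) • (-e)) (-e)) := by
      intro m
      rw [hFn, inner_neg_right]
      push_cast
      rw [show v + (-((m : ℝ) + 1)) • e = v + ((m : ℝ) + 1) • (-e) by rw [smul_neg, neg_smul]]
      ring
    have hsumG : ∑' m : ℕ, F c s d (-((m : ℤ) + 1)) =
        -∑' m : ℕ, ljSqDeriv (‖v + ((m : ℝ) + 1) • (-e)‖ ^ 2) * inner ℝ (v + ((m : ℝ) + 1) • (-e)) (-e) := by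
      rw [← tsum_neg]; exact tsum_congr hG
    have hF0 : F c s d 0 = ljSqDeriv (‖v‖ ^ 2) * inner ℝ v e := by
      rw [hFn]; simp
    have hasy := h1_tail_asymp_sharp hvpos hepos' hve'
    rw [norm_neg, inner_neg_right] at hasy
    rw [hsumG, hF0]
    have e2 : -(ljSqDeriv (‖v‖ ^ 2) * inner ℝ v e +
          -∑' m : ℕ, ljSqDeriv (‖v + ((m : ℝ) + 1) • (-e)‖ ^ 2) * inner ℝ (v + ((m : ℝ) + 1) • (-e)) (-e)) +
          1 / 2 * lennardJones ‖v‖ + 1 / 2 * (ljSqDeriv (‖v‖ ^ 2) * inner ℝ v e) =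
        ∑' m : ℕ, ljSqDeriv (‖v + ((m : ℝ) + 1) • (-e)‖ ^ 2) * inner ℝ (v + ((m : ℝ) + 1) • (-e)) (-e) +
          1 / 2 * lennardJones ‖v‖ + 1 / 2 * (ljSqDeriv (‖v‖ ^ 2) * -inner ℝ v e) := by ring
    rw [e2]
    exact hasy

/-- **Sharp first-order form**: `|τ c s d + ½V_LJ(r)| ≤ ¼(1 + r⁻⁶)‖y_s‖r⁻⁷ + ((14 + 56r⁻⁶)/32)‖y_s‖²r⁻⁸` — the statement
of `h1_tau_asymp` with constants of order one. [folklore] -/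
theorem h1_tau_asymp_sharp (ha : 0 < a) (hh : 0 < h)
    (hV : ∀ c d, V c d = if c = true then hcpSite a h d else -hcpSite a h (-d))
    (hF : ∀ c s d n, F c s d n =
      ljSqDeriv (‖V c (d + n • s)‖ ^ 2) * inner ℝ (V c (d + n • s)) (hcpSite a h s))
    (hτ : ∀ c s d, τ c s d = if 0 ≤ inner ℝ (V c d) (hcpSite a h s) then ∑' m : ℕ, F c s d ((m : ℤ) + 1)
      else -(F c s d 0 + ∑' m : ℕ, F c s d (-((m : ℤ) + 1))))
    (c : Bool) {s : ℤ × ℤ × ℤ} (hs : s ∈ ({(0, 1, 0), (0, 0, 1), (0, -1, 1), (2, 0, 0)} : Finset (ℤ × ℤ × ℤ)))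
    {d : ℤ × ℤ × ℤ} (hd : d ≠ 0) :
    |τ c s d + 1 / 2 * lennardJones ‖V c d‖| ≤
      1 / 4 * (1 + (‖V c d‖⁻¹) ^ 6) * ‖hcpSite a h s‖ * (‖V c d‖⁻¹) ^ 7 +
        (14 + 56 * (‖V c d‖⁻¹) ^ 6) / 32 * (‖hcpSite a h s‖ ^ 2 * (‖V c d‖⁻¹) ^ 8) := by
  have h2 := h1_tau_asymp2 ha hh hV hF hτ c hs hd
  set e := hcpSite a h s with he_def
  set v := V c d with hv_def
  have hρ : 0 < min a h := lt_min ha hh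
  have hvpos : 0 < ‖v‖ := hρ.trans_le (h1_V_norm_ge ha hh hV c hd)
  have hT := h1_T_abs_le hvpos le_rfl e
  have hc' : ((‖v‖ ^ 2)⁻¹) ^ 3 = (‖v‖⁻¹) ^ 6 := by rw [inv_pow, inv_pow, ← pow_mul]
  rw [hc'] at hT
  have e1 : τ c s d + 1 / 2 * lennardJones ‖v‖ =
      (τ c s d + 1 / 2 * lennardJones ‖v‖ + 1 / 2 * (ljSqDeriv (‖v‖ ^ 2) * inner ℝ v e)) -
        1 / 2 * (ljSqDeriv (‖v‖ ^ 2) * inner ℝ v e) := by ring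
  rw [e1]
  refine (abs_sub _ _).trans ?_
  rw [add_comm]
  refine add_le_add ?_ h2
  rw [abs_mul, abs_of_nonneg (by norm_num : (0 : ℝ) ≤ 1 / 2)]
  have : 1 / 2 * |ljSqDeriv (‖v‖ ^ 2) * inner ℝ v e| ≤ 1 / 2 * (1 / 2 * (1 + (‖v‖⁻¹) ^ 6) * ‖e‖ * (‖v‖⁻¹) ^ 7) :=
    mul_le_mul_of_nonneg_left hT (by norm_num)
  refine this.trans (le_of_eq ?_)
  ring

/-- **The inflation factor, sharp form.**  `12r⁶·τ c s d ≤ 1 + 3(1+r⁻⁶)(‖y_s‖/r) + (21/4 + 21r⁻⁶)(‖y_s‖/r)²`, `r = ‖V c d‖`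
(first order sharp in the directions `V c d ∥ ±y_s`, second-order constant `21/4` attained asymptotically there). [folklore] -/
theorem h1_tau_inflation_le (ha : 0 < a) (hh : 0 < h)
    (hV : ∀ c d, V c d = if c = true then hcpSite a h d else -hcpSite a h (-d))
    (hF : ∀ c s d n, F c s d n =
      ljSqDeriv (‖V c (d + n • s)‖ ^ 2) * inner ℝ (V c (d + n • s)) (hcpSite a h s))
    (hτ : ∀ c s d, τ c s d = if 0 ≤ inner ℝ (V c d) (hcpSite a h s) then ∑' m : ℕ, F c s d ((m : ℤ) + 1)
      else -(F c s d 0 + ∑' m : ℕ, F c s d (-((m : ℤ) + 1))))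
    (c : Bool) {s : ℤ × ℤ × ℤ} (hs : s ∈ ({(0, 1, 0), (0, 0, 1), (0, -1, 1), (2, 0, 0)} : Finset (ℤ × ℤ × ℤ)))
    {d : ℤ × ℤ × ℤ} (hd : d ≠ 0) :
    12 * ‖V c d‖ ^ 6 * τ c s d ≤
      1 + 3 * (1 + (‖V c d‖⁻¹) ^ 6) * (‖hcpSite a h s‖ * ‖V c d‖⁻¹) +
        (21 / 4 + 21 * (‖V c d‖⁻¹) ^ 6) * (‖hcpSite a h s‖ * ‖V c d‖⁻¹) ^ 2 := by
  have hsharp := h1_tau_asymp_sharp ha hh hV hF hτ c hs hd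
  set e := hcpSite a h s with he_def
  set v := V c d with hv_def
  set r := ‖v‖ with hr_def
  set ε := ‖e‖ with hε_def
  have hρ : 0 < min a h := lt_min ha hh
  have hr : 0 < r := hρ.trans_le (h1_V_norm_ge ha hh hV c hd)
  have hup : τ c s d ≤ -(1 / 2 * lennardJones r) +
      (1 / 4 * (1 + (r⁻¹) ^ 6) * ε * (r⁻¹) ^ 7 + (14 + 56 * (r⁻¹) ^ 6) / 32 * (ε ^ 2 * (r⁻¹) ^ 8)) := by
    have := (abs_le.mp hsharp).2; linarith
  have h12 : (0 : ℝ) ≤ 12 * r ^ 6 := by positivity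
  have hmul := mul_le_mul_of_nonneg_left hup h12
  have hid : 12 * r ^ 6 * (-(1 / 2 * lennardJones r) +
      (1 / 4 * (1 + (r⁻¹) ^ 6) * ε * (r⁻¹) ^ 7 + (14 + 56 * (r⁻¹) ^ 6) / 32 * (ε ^ 2 * (r⁻¹) ^ 8))) =
      1 - 1 / 2 * (r⁻¹) ^ 6 + (3 * (1 + (r⁻¹) ^ 6) * (ε * r⁻¹) + (21 / 4 + 21 * (r⁻¹) ^ 6) * (ε * r⁻¹) ^ 2) := by
    rw [lennardJones]
    field_simp
    ring
  rw [hid] at hmul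
  have hx6 : 0 ≤ 1 / 2 * (r⁻¹) ^ 6 := by positivity
  linarith

/-- **Numerical inflation factors from the interface on** (`‖y_s‖ ≤ 2h < 8/5` on the certified `(a,h)`-box; the far region of
the H12⋆ architecture starts at `R₁ = 4.05a > 39/10`): `12r⁶τ ≤ 16/5` for `r ≥ 39/10`, `≤ 19/10` for `r ≥ 77/10`, `≤ 13/10` for
`r ≥ 19` — a KERNEL-ONLY true-β inflation bound for every far bond (true sup: `2.64 / 1.75 / 1.27`; HOME CERT §21). [folklore] -/
theorem h1_tau_inflation_num (ha : 0 < a) (hh : 0 < h)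
    (hV : ∀ c d, V c d = if c = true then hcpSite a h d else -hcpSite a h (-d))
    (hF : ∀ c s d n, F c s d n =
      ljSqDeriv (‖V c (d + n • s)‖ ^ 2) * inner ℝ (V c (d + n • s)) (hcpSite a h s))
    (hτ : ∀ c s d, τ c s d = if 0 ≤ inner ℝ (V c d) (hcpSite a h s) then ∑' m : ℕ, F c s d ((m : ℤ) + 1)
      else -(F c s d 0 + ∑' m : ℕ, F c s d (-((m : ℤ) + 1))))
    (c : Bool) {s : ℤ × ℤ × ℤ} (hs : s ∈ ({(0, 1, 0), (0, 0, 1), (0, -1, 1), (2, 0, 0)} : Finset (ℤ × ℤ × ℤ)))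
    {d : ℤ × ℤ × ℤ} (hd : d ≠ 0) (hys : ‖hcpSite a h s‖ ≤ 8 / 5) :
    (39 / 10 ≤ ‖V c d‖ → 12 * ‖V c d‖ ^ 6 * τ c s d ≤ 16 / 5) ∧
      (77 / 10 ≤ ‖V c d‖ → 12 * ‖V c d‖ ^ 6 * τ c s d ≤ 19 / 10) ∧
        (19 ≤ ‖V c d‖ → 12 * ‖V c d‖ ^ 6 * τ c s d ≤ 13 / 10) := by
  have hinf := h1_tau_inflation_le ha hh hV hF hτ c hs hd
  set e := hcpSite a h s with he_def
  set v := V c d with hv_def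
  set r := ‖v‖ with hr_def
  set ε := ‖e‖ with hε_def
  have hρ : 0 < min a h := lt_min ha hh
  have hr : 0 < r := hρ.trans_le (h1_V_norm_ge ha hh hV c hd)
  have hε0 : 0 ≤ ε := norm_nonneg _
  have hx0 : 0 ≤ r⁻¹ := inv_nonneg.mpr hr.le
  -- generic step: bound by the value at `(x, y) = (X, Y)` when `r⁻¹ ≤ X`, `ε r⁻¹ ≤ Y`
  have step : ∀ X Y : ℝ, r⁻¹ ≤ X → ε * r⁻¹ ≤ Y →
      12 * r ^ 6 * τ c s d ≤ 1 + 3 * (1 + X ^ 6) * Y + (21 / 4 + 21 * X ^ 6) * Y ^ 2 := by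
    intro X Y hX hY
    have hy0 : 0 ≤ ε * r⁻¹ := by positivity
    refine hinf.trans ?_
    gcongr
  refine ⟨fun h39 => ?_, fun h77 => ?_, fun h19 => ?_⟩
  · have hX : r⁻¹ ≤ 10 / 39 := by rw [inv_le_comm₀ hr (by norm_num)]; norm_num; exact h39
    have hY : ε * r⁻¹ ≤ 8 / 5 * (10 / 39) := mul_le_mul hys hX hx0 (by norm_num)
    refine (step _ _ hX hY).trans ?_
    norm_num
  · have hX : r⁻¹ ≤ 10 / 77 := by rw [inv_le_comm₀ hr (by norm_num)]; norm_num; exact h77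
    have hY : ε * r⁻¹ ≤ 8 / 5 * (10 / 77) := mul_le_mul hys hX hx0 (by norm_num)
    refine (step _ _ hX hY).trans ?_
    norm_num
  · have hX : r⁻¹ ≤ 1 / 19 := by rw [inv_le_comm₀ hr (by norm_num)]; norm_num; exact h19
    have hY : ε * r⁻¹ ≤ 8 / 5 * (1 / 19) := mul_le_mul hys hX hx0 (by norm_num)
    refine (step _ _ hX hY).trans ?_
    norm_num

/-- On the `(a,h)`-box of the hcp-family minimiser (`a ≤ 8/5` and `h ≤ 4/5` suffice; the tree's `hcpFamilyMin_enclosure` gives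
`a ≤ 0.9714`, `h ≤ 0.79304`) every stencil vector of `Y₁` has `‖y_s‖ ≤ 8/5` (`‖y_s‖ ∈ {a, 2h}`, `h1_stencil_norm_sq`). [folklore] -/
theorem h1_stencil_norm_le_box (ha : 0 < a) (hh : 0 < h) (ha' : a ≤ 8 / 5) (hh' : h ≤ 4 / 5) {s : ℤ × ℤ × ℤ}
    (hs : s ∈ ({(0, 1, 0), (0, 0, 1), (0, -1, 1), (2, 0, 0)} : Finset (ℤ × ℤ × ℤ))) :
    ‖hcpSite a h s‖ ≤ 8 / 5 := by
  have hsq := h1_stencil_norm_sq a h hs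
  have hn : 0 ≤ ‖hcpSite a h s‖ := norm_nonneg _
  split_ifs at hsq with h0
  · have : ‖hcpSite a h s‖ = a := (pow_left_inj₀ hn ha.le two_ne_zero).mp (by rw [hsq])
    linarith
  · have : ‖hcpSite a h s‖ = 2 * h := (pow_left_inj₀ hn (by linarith) two_ne_zero).mp (by rw [hsq]; ring)
    linarith

/-- **The true-β inflation bound on the minimiser's box, no side conditions**: for `0 < a ≤ 8/5`, `0 < h ≤ 4/5` (in particular
at every `(a,h)` of the certified enclosure of the hcp-family minimiser), every stencil direction `s ∈ Y₁`, every `d ≠ 0` and both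
orientations: `12r⁶·τ c s d ≤ 16/5` once `r = ‖V c d‖ ≥ 39/10` (every far bond of the H12⋆ split, `R₁ = 4.05a`), `≤ 19/10` once
`r ≥ 77/10`, `≤ 13/10` once `r ≥ 19`. [folklore] -/
theorem h1_tau_inflation_box (ha : 0 < a) (hh : 0 < h) (ha' : a ≤ 8 / 5) (hh' : h ≤ 4 / 5)
    (hV : ∀ c d, V c d = if c = true then hcpSite a h d else -hcpSite a h (-d))
    (hF : ∀ c s d n, F c s d n =
      ljSqDeriv (‖V c (d + n • s)‖ ^ 2) * inner ℝ (V c (d + n • s)) (hcpSite a h s))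
    (hτ : ∀ c s d, τ c s d = if 0 ≤ inner ℝ (V c d) (hcpSite a h s) then ∑' m : ℕ, F c s d ((m : ℤ) + 1)
      else -(F c s d 0 + ∑' m : ℕ, F c s d (-((m : ℤ) + 1))))
    (c : Bool) {s : ℤ × ℤ × ℤ} (hs : s ∈ ({(0, 1, 0), (0, 0, 1), (0, -1, 1), (2, 0, 0)} : Finset (ℤ × ℤ × ℤ)))
    {d : ℤ × ℤ × ℤ} (hd : d ≠ 0) :
    (39 / 10 ≤ ‖V c d‖ → 12 * ‖V c d‖ ^ 6 * τ c s d ≤ 16 / 5) ∧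
      (77 / 10 ≤ ‖V c d‖ → 12 * ‖V c d‖ ^ 6 * τ c s d ≤ 19 / 10) ∧
        (19 ≤ ‖V c d‖ → 12 * ‖V c d‖ ^ 6 * τ c s d ≤ 13 / 10) :=
  h1_tau_inflation_num ha hh hV hF hτ c hs hd (h1_stencil_norm_le_box ha hh ha' hh' hs)

end Tau3

end Summit.AtomisticToContinuum.Crystallization.Theorems.StrictSplittingRuleBirth

end
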